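import Mathlib
import Summits.Ventures.PercRepro2.ParallelEdge
import Summits.Ventures.PercRepro2.MixChordClasses
import Summits.Ventures.PercRepro2.MixChordCoincidence
import Summits.Ventures.PercRepro2.HCovSwap

/-!
# The doubling lemma for the root-edge classes: the `o`-class `D`-LAW row follows from the `o`-class
`D`-CHORD row (blind cell PercRepro2, night-1 g21; proofs/NIGHT1-G21.md §4)

The copy of a root edge of the `o`-class is a root edge of the `o`-class of the doubled instance
(`none_mem_rootEdges_pP`, `oClass_pP`: the weight-`1` clusters transport through the merge,
`cluster_oneConfig_pP`), the open child of an `o`-class root edge has `Gc = 0`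
(`Gc_update_one_eq_zero_of_oClass`: `o` is surely joined to the root), and the chord along the copy at
the weights `r ∈ {0, 1}` is trivial.  Hence the row **`DChordO_all`** (the `D`-chord along every
`o`-class root edge, on all instances — the two q-free rows `oRow0 ≥ 0`, `oRow1 ≥ 0` of
`MixChordORows.lean`) implies the row **`DLawO_all`** of `MixChordLaw.lean` (the monotone `D`-law,
the census object): **`DLawO_all_of_DChordO_all`**.  With `nMixChord_of_nLaw` the two rows are
equivalent over the class of all instances.

Own code; standard axioms.
-/

namespace Summit.Ventures.PercRepro2

open UnionCluster CovForm

namespace ParallelEdge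

open scoped Classical

section Transport

variable {V : Type*} {E : Type*} [DecidableEq E] {R : Type*} [Field R] [LinearOrder R]

variable {p : E → R} {ends : E → Sym2 V} {e : E} {q₁ r : R}

/-- The doubled weights are admissible. -/
lemma isProbVec_pP (hp : IsProbVec p) (hq0 : 0 ≤ q₁) (hq1 : q₁ ≤ 1) (hr0 : 0 ≤ r)
    (hr1 : r ≤ 1) : IsProbVec (pP p e q₁ r) := by
  refine ⟨fun g => ?_, fun g => ?_⟩
  · cases g with
    | none => simpa using hr0
    | some g => exact (hp.update e hq0 hq1).nonneg g
  · cases g with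
    | none => simpa using hr1
    | some g => exact (hp.update e hq0 hq1).le_one g

/-- The weight-`1` configuration of the doubled instance merges to that of `p[e ↦ q₁]` when the
copy is not sure. -/
lemma Ψ_oneConfig (hr : r ≠ 1) :
    Ψ e (Chord.oneConfig (pP p e q₁ r)) = Chord.oneConfig (Function.update p e q₁) := by
  funext g
  by_cases h : g = e
  · subst h
    simp [Chord.oneConfig, Ψ, hr]
  · rw [Ψ_of_ne e _ h]
    simp [Chord.oneConfig, pP]

/-- The weight-`1` clusters of the doubled instance are those of `p[e ↦ q₁]`. -/
lemma cluster_oneConfig_pP (hr : r ≠ 1) (v : V) :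
    cluster (endsP ends e) (Chord.oneConfig (pP p e q₁ r)) v =
      cluster ends (Chord.oneConfig (Function.update p e q₁)) v := by
  ext u
  rw [mem_cluster, mem_cluster, conn_parallel, Ψ_oneConfig hr]

variable [Fintype E]

/-- Re-weighting a fractional edge can only add weight-`1` edges. -/
lemma oneConfig_le_update (hfrac : e ∈ Chord.frac p) (q : R) :
    Chord.oneConfig p ≤ Chord.oneConfig (Function.update p e q) := by
  intro g
  by_cases h : g = e
  · subst h
    have : Chord.oneConfig p g = false := by
      simp [Chord.oneConfig, (Chord.mem_frac.1 hfrac).2]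
    rw [this]
    exact Bool.false_le _
  · simp [Chord.oneConfig, Function.update_of_ne h]

/-- The weight-`1` clusters of `p` are inside those of `p[e ↦ q]` (`e` fractional). -/
lemma cluster_oneConfig_subset (hfrac : e ∈ Chord.frac p) (q : R) (v : V) :
    cluster ends (Chord.oneConfig p) v ⊆ cluster ends (Chord.oneConfig (Function.update p e q)) v :=
  fun _ hu => conn_mono (oneConfig_le_update hfrac q) hu

/-- **The copy of a root edge is a root edge of the doubled instance** (copy fractional). -/
lemma none_mem_rootEdges_pP {a₁ a₂ : V} (he : e ∈ Chord.rootEdges p ends a₁ a₂) (hr0 : r ≠ 0)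
    (hr1 : r ≠ 1) : none ∈ Chord.rootEdges (pP p e q₁ r) (endsP ends e) a₁ a₂ := by
  have hfrac := Chord.frac_of_mem_rootEdges he
  have he' := he
  unfold Chord.rootEdges at he' ⊢
  rw [Finset.mem_filter] at he' ⊢
  obtain ⟨_, ht⟩ := he'
  refine ⟨?_, ?_⟩
  · rw [Chord.mem_frac]
    exact ⟨by simpa using hr0, by simpa using hr1⟩
  · obtain ⟨x, hx, y, hxy⟩ := mem_touches.1 ht
    refine mem_touches.2 ⟨x, ?_, y, hxy⟩
    unfold Chord.rootSet at hx ⊢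
    rw [cluster_oneConfig_pP hr1, cluster_oneConfig_pP hr1]
    rcases hx with hx | hx
    · exact Or.inl (cluster_oneConfig_subset hfrac q₁ a₁ hx)
    · exact Or.inr (cluster_oneConfig_subset hfrac q₁ a₂ hx)

/-- **The `o`-class transports to the copy.** -/
lemma oClass_pP {o a₁ a₂ : V} (hfrac : e ∈ Chord.frac p) (hr1 : r ≠ 1)
    (hO : Mix.OClass p ends o a₁ a₂ e) :
    Mix.OClass (pP p e q₁ r) (endsP ends e) o a₁ a₂ none := by
  obtain ⟨x, y, hxy, hx, hy⟩ := hO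
  refine ⟨x, y, hxy, ?_, ?_⟩
  · rw [cluster_oneConfig_pP hr1, cluster_oneConfig_pP hr1]
    rcases hx with hx | hx
    · exact Or.inl (cluster_oneConfig_subset hfrac q₁ a₁ hx)
    · exact Or.inr (cluster_oneConfig_subset hfrac q₁ a₂ hx)
  · rw [cluster_oneConfig_pP hr1]
    exact cluster_oneConfig_subset hfrac q₁ y hy

variable [IsStrictOrderedRing R]

/-- On the support of `p[e ↦ 1]`, a root joined in the weight-`1` graph to an end of `e` is joined
to every vertex in the weight-`1` cluster of the other end. -/
lemma conn_of_oClass_support {x y v z : V} (hxy : ends e = s(x, y))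
    (hx : x ∈ cluster ends (Chord.oneConfig p) v) (hz : z ∈ cluster ends (Chord.oneConfig p) y)
    {ω : Config E} (hω : weight (Function.update p e 1) ω ≠ 0) : Conn ends ω v z := by
  have h1 : Chord.oneConfig (Function.update p e 1) ≤ ω := Mix.oneConfig_le_of_weight_ne_zero hω
  have h0 : Chord.oneConfig p ≤ ω := (Mix.oneConfig_le_update_one p e).trans h1
  have hωe : ω e = true := by
    have h := h1 e
    have he1 : Chord.oneConfig (Function.update p e 1) e = true := by
      simp [Chord.oneConfig]
    rw [he1] at h
    exact Bool.le_iff_imp.1 h rfl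
  have hvx : Conn ends ω v x := conn_mono h0 (mem_cluster.1 hx)
  have hxy' : Conn ends ω x y := conn_of_openAdj ⟨e, hωe, hxy⟩
  have hyz : Conn ends ω y z := conn_mono h0 (mem_cluster.1 hz)
  exact conn_trans (conn_trans hvx hxy') hyz

/-- **The open child of an `o`-class root edge has `Gc = 0`**: `o` is surely joined to a root. -/
theorem Gc_update_one_eq_zero_of_oClass {o a₁ a₂ : V} (hO : Mix.OClass p ends o a₁ a₂ e)
    (a₃ b : V) : Gc (Function.update p e 1) ends o a₁ a₂ a₃ b = 0 := by
  obtain ⟨x, y, hxy, hx, hy⟩ := hO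
  rcases hx with hx | hx
  · exact Mix.Gc_eq_zero_of_sure_conn_o _ ends o a₃ b fun ω hω =>
      conn_of_oClass_support hxy hx hy hω
  · rw [← Gc_swap]
    exact Mix.Gc_eq_zero_of_sure_conn_o _ ends o a₃ b fun ω hω =>
      conn_of_oClass_support hxy hx hy hω

end Transport

section Rows

variable (R : Type*) [Field R] [LinearOrder R] [IsStrictOrderedRing R]

/-- **Row (CHORD-D-o)**: the `D`-chord along every root edge of the `o`-class, on all instances
(the two q-free rows of `MixChordORows.lean`). -/
def DChordO_all : Prop :=
  ∀ (V E : Type) [Fintype V] [DecidableEq V] [Fintype E] [DecidableEq E]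
    (ends : E → Sym2 V) (p : E → R), IsProbVec p →
    ∀ o a₁ a₂ a₃ b : V, a₁ ≠ a₂ → a₁ ≠ a₃ → a₂ ≠ a₃ → o ≠ a₁ → o ≠ a₂ → o ≠ a₃ → o ≠ b →
      b ≠ a₁ → b ≠ a₂ → b ≠ a₃ →
      ∀ e ∈ Chord.rootEdges p ends a₁ a₂, Mix.OClass p ends o a₁ a₂ e →
        Mix.NMixChord (Mix.normD ends a₁ a₂ a₃) p ends o a₁ a₂ a₃ b e

/-- **The doubling lemma for the `o`-class: the chord row implies the law row.** -/
theorem DLawO_all_of_DChordO_all (h : DChordO_all R) : Mix.DLawO_all R := by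
  intro V E _ _ _ _ ends p hp o a₁ a₂ a₃ b h12 h13 h23 ho1 ho2 ho3 hob hb1 hb2 hb3 e he hO
  refine nLaw_normD_of_nMixChord_parallel (Gc_update_one_eq_zero_of_oClass hO a₃ b) ?_
  intro q₁ r hq₁0 hq₁1 hr0 hr1
  rcases eq_or_lt_of_le hr0 with hr0' | hr0'
  · -- the copy closed: the chord is an equality
    subst hr0'
    unfold Mix.NMixChord
    rw [pP_update_none_zero, pP_none]
    simp
  rcases eq_or_lt_of_le hr1 with hr1' | hr1'
  · -- the copy sure: both sides vanish
    subst hr1'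
    unfold Mix.NMixChord
    rw [pP_update_none_one, pP_none]
    simp
  · exact h V (Option E) (endsP ends e) (pP p e q₁ r) (isProbVec_pP hp hq₁0 hq₁1 hr0 hr1) o a₁ a₂
      a₃ b h12 h13 h23 ho1 ho2 ho3 hob hb1 hb2 hb3 none (none_mem_rootEdges_pP he hr0'.ne' hr1'.ne)
      (oClass_pP (Chord.frac_of_mem_rootEdges he) hr1'.ne hO)

/-- **The law row is the chord row** over the class of all instances. -/
theorem DLawO_all_iff_DChordO_all : Mix.DLawO_all R ↔ DChordO_all R :=
  ⟨fun h V E _ _ _ _ ends p hp o a₁ a₂ a₃ b h12 h13 h23 ho1 ho2 ho3 hob hb1 hb2 hb3 e he hO =>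
      Mix.nMixChord_of_nLaw hp
        (h V E ends p hp o a₁ a₂ a₃ b h12 h13 h23 ho1 ho2 ho3 hob hb1 hb2 hb3 e he hO),
    DLawO_all_of_DChordO_all R⟩

end Rows

end ParallelEdge

end Summit.Ventures.PercRepro2
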